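import Mathlib.FieldTheory.KummerPolynomial
import Mathlib.FieldTheory.IsAlgClosed.AlgebraicClosure
import Mathlib.NumberTheory.Padics.PadicNumbers
import Literature.AnabelianGeometry.AbsoluteAnabelian.FundamentalExtension
import HarnessLib

/-!
# The absolute Galois group of an MLF is infinite

Mochizuki, *Topics in absolute anabelian geometry I*, §0 p. 7: "a finite field extension of `ℚ_p` …
will be referred to as an MLF" (`Literature.AnabelianGeometry.AbsoluteAnabelian.IsMLF`, abc-iut-L4-t1)
[cite: MochizukiAbsTopI2012, §0 p.7]; the fact recorded here — `G_k = Gal(k̄/k)` is INFINITE for an MLF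
`k` — is the instance input `[Infinite D.Gk]` of the [IUTchI] Cor. 2.5 kernels
(`Literature.IUT.HodgeTheaters.StableCurveTemperedData.cor25Decomposition_byName` / `cor25_byName`,
abc-iut-L5-t11: "an open subgroup of an infinite compact group is nontrivial") at the merge `D.Gk := G_k`
[cite: Mochizuki2012, Cor 2.5 p.51] (D-0012 claim key for [IUTchI]; nothing of the series is asserted).
PROOF-ONLY file (seat abc-iut-w4-d055); classical algebra only:

* `Field.natDegree_minpoly_le_card_absoluteGaloisGroup` — if `Gal(F̄/F)` is finite, every element of `F̄`
  with separable minimal polynomial has degree `≤ #Gal(F̄/F)` (its conjugates are the roots of its minimal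
  polynomial, `Algebra.IsAlgebraic.range_eval_eq_rootSet_minpoly`);
* `Field.infinite_absoluteGaloisGroup_of_irreducible` — hence monic irreducible separable polynomials of
  unbounded degree force `Gal(F̄/F)` to be infinite;
* `Padic.infinite_absoluteGaloisGroup` — over `ℚ_p`, `X^ℓ − p` is irreducible for every prime `ℓ`
  (Kummer's criterion, Lang *Algebra* VI §9 Thm. 9.1 = Mathlib `X_pow_sub_C_irreducible_iff_of_prime`;
  `p` is not an `ℓ`-th power by valuation);
* `IsMLF.infinite_absoluteGaloisGroup` — over an MLF `K ⊇ ℚ_p`, `X^ℓ − p` stays irreducible for primes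
  `ℓ > [K : ℚ_p]` (an `ℓ`-th root of `p` has degree `ℓ` over `ℚ_p`).

No new definition, no new Literature fact; nothing here bears on [IUTchIII] Cor. 3.12.
-/

namespace Literature.AnabelianGeometry.AbsoluteAnabelian

open Polynomial

universe u

/-! ### Degrees are bounded by the order of a finite absolute Galois group -/

/-- If `Gal(F̄/F)` is finite, an element of `F̄` with separable minimal polynomial has degree at most
`#Gal(F̄/F)`: its conjugates — the roots of its minimal polynomial in `F̄` — are the values at it of the
`F`-automorphisms of `F̄`. [cite: Mochizuki2012, Cor 2.5 p.51] -/
theorem _root_.Field.natDegree_minpoly_le_card_absoluteGaloisGroup (F : Type u) [Field F]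
    [Finite (Field.absoluteGaloisGroup F)] (x : AlgebraicClosure F) (hsep : (minpoly F x).Separable) :
    (minpoly F x).natDegree ≤ Nat.card (Field.absoluteGaloisGroup F) := by
  classical
  let K := AlgebraicClosure F
  have hsplit : ((minpoly F x).map (algebraMap F K)).Splits := IsAlgClosed.splits _
  have hcard : Fintype.card ((minpoly F x).rootSet K) = (minpoly F x).natDegree :=
    Polynomial.card_rootSet_eq_natDegree hsep hsplit
  have hrange : Set.range (fun ψ : K →ₐ[F] K => ψ x) = (minpoly F x).rootSet K :=
    Algebra.IsAlgebraic.range_eval_eq_rootSet_minpoly K x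
  haveI hG : Finite (K ≃ₐ[F] K) := ‹Finite (Field.absoluteGaloisGroup F)›
  haveI : Finite (K →ₐ[F] K) :=
    Finite.of_equiv _ (Algebra.IsAlgebraic.algEquivEquivAlgHom F K).toEquiv
  have h1 : Nat.card ((minpoly F x).rootSet K) ≤ Nat.card (K →ₐ[F] K) := by
    rw [← hrange]
    exact Nat.card_le_card_of_surjective _ Set.rangeFactorization_surjective
  have h2 : Nat.card (K →ₐ[F] K) = Nat.card (Field.absoluteGaloisGroup F) :=
    Nat.card_congr (Algebra.IsAlgebraic.algEquivEquivAlgHom F K).toEquiv.symm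
  rw [← hcard, ← Nat.card_eq_fintype_card, ← h2]
  exact h1

/-- **Monic irreducible separable polynomials of unbounded degree make `Gal(F̄/F)` infinite.**
[cite: Mochizuki2012, Cor 2.5 p.51] -/
theorem _root_.Field.infinite_absoluteGaloisGroup_of_irreducible (F : Type u) [Field F]
    (h : ∀ n : ℕ, ∃ q : F[X], q.Monic ∧ Irreducible q ∧ q.Separable ∧ n ≤ q.natDegree) :
    Infinite (Field.absoluteGaloisGroup F) := by
  classical
  by_contra hinf
  rw [not_infinite_iff_finite] at hinf
  obtain ⟨q, hmon, hirr, hsep, hdeg⟩ := h (Nat.card (Field.absoluteGaloisGroup F) + 1)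
  have hq0 : q.degree ≠ 0 := by
    rw [Polynomial.degree_eq_natDegree hmon.ne_zero]
    exact_mod_cast (show q.natDegree ≠ 0 by omega)
  obtain ⟨x, hx⟩ := IsAlgClosed.exists_aeval_eq_zero (AlgebraicClosure F) q hq0
  have hmin : q = minpoly F x := minpoly.eq_of_irreducible_of_monic hirr hx hmon
  have hle := Field.natDegree_minpoly_le_card_absoluteGaloisGroup F x (hmin ▸ hsep)
  rw [← hmin] at hle
  omega

/-! ### `ℚ_p`: Kummer polynomials `X^ℓ - p` -/

section Padic

variable (p : ℕ) [Fact p.Prime]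

/-- `p` is not an `ℓ`-th power in `ℚ_p` for `ℓ ≥ 2` (valuations: `v(b^ℓ) = ℓ·v(b) ≠ 1 = v(p)`).
[cite: Mochizuki2012, Cor 2.5 p.51] -/
theorem _root_.Padic.forall_pow_ne_natCast {ℓ : ℕ} (hℓ : 2 ≤ ℓ) : ∀ b : ℚ_[p], b ^ ℓ ≠ (p : ℚ_[p]) := by
  intro b hb
  have hv := congrArg Padic.valuation hb
  rw [Padic.valuation_pow, Padic.valuation_p] at hv
  have hdvd : (ℓ : ℤ) ∣ 1 := ⟨b.valuation, hv.symm⟩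
  have : (ℓ : ℤ) = 1 := Int.eq_one_of_dvd_one (by positivity) hdvd
  omega

/-- **`X^ℓ − p` is irreducible over `ℚ_p` for every prime `ℓ`** (Kummer's criterion, Lang *Algebra* VI §9
Thm. 9.1). [cite: Mochizuki2012, Cor 2.5 p.51] -/
theorem _root_.Padic.irreducible_X_pow_sub_C_natCast {ℓ : ℕ} (hℓ : ℓ.Prime) :
    Irreducible (X ^ ℓ - C (p : ℚ_[p])) :=
  (X_pow_sub_C_irreducible_iff_of_prime hℓ).2 (Padic.forall_pow_ne_natCast p hℓ.two_le)

/-- **`Gal(ℚ̄_p/ℚ_p)` is infinite.** [cite: Mochizuki2012, Cor 2.5 p.51] -/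
theorem _root_.Padic.infinite_absoluteGaloisGroup : Infinite (Field.absoluteGaloisGroup ℚ_[p]) := by
  refine Field.infinite_absoluteGaloisGroup_of_irreducible ℚ_[p] fun n => ?_
  obtain ⟨ℓ, hnℓ, hℓ⟩ := Nat.exists_infinite_primes (n + 2)
  have hirr := Padic.irreducible_X_pow_sub_C_natCast p hℓ
  refine ⟨X ^ ℓ - C (p : ℚ_[p]), monic_X_pow_sub_C _ hℓ.ne_zero, hirr,
    PerfectField.separable_of_irreducible hirr, ?_⟩
  rw [natDegree_X_pow_sub_C]
  omega

end Padic

/-! ### MLFs -/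

/-- Over a finite extension `K` of `ℚ_p` (degree `d`), `p` is not an `ℓ`-th power for any prime `ℓ > d`:
an `ℓ`-th root of `p` has degree exactly `ℓ` over `ℚ_p`. [cite: Mochizuki2012, Cor 2.5 p.51] -/
theorem forall_pow_ne_algebraMap_of_finrank_lt {K : Type u} [Field K] (p : ℕ) [Fact p.Prime]
    [Algebra ℚ_[p] K] [Module.Finite ℚ_[p] K] {ℓ : ℕ} (hℓ : ℓ.Prime)
    (hd : Module.finrank ℚ_[p] K < ℓ) : ∀ b : K, b ^ ℓ ≠ algebraMap ℚ_[p] K p := by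
  intro b hb
  have hx : aeval b (X ^ ℓ - C (p : ℚ_[p])) = 0 := by
    simp only [map_sub, map_pow, aeval_X, aeval_C, hb, sub_self]
  have hmin : X ^ ℓ - C (p : ℚ_[p]) = minpoly ℚ_[p] b :=
    minpoly.eq_of_irreducible_of_monic (Padic.irreducible_X_pow_sub_C_natCast p hℓ) hx
      (monic_X_pow_sub_C _ hℓ.ne_zero)
  have hle : (minpoly ℚ_[p] b).natDegree ≤ Module.finrank ℚ_[p] K := minpoly.natDegree_le b
  rw [← hmin, natDegree_X_pow_sub_C] at hle
  omega

/-- **The absolute Galois group of an MLF is infinite**: `Gal(k̄/k)` is an infinite (profinite) group for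
every finite extension `k` of `ℚ_p` — the instance input `[Infinite D.Gk]` of the [IUTchI] Cor. 2.5
kernels at `D.Gk := G_k`. [cite: Mochizuki2012, Cor 2.5 p.51] -/
theorem IsMLF.infinite_absoluteGaloisGroup {K : Type u} [Field K] (hK : IsMLF K) :
    Infinite (Field.absoluteGaloisGroup K) := by
  obtain ⟨p, hp, f, hfin⟩ := hK.exists_padic
  letI : Algebra ℚ_[p] K := f.toAlgebra
  haveI : Module.Finite ℚ_[p] K := hfin
  haveI : CharZero K := charZero_of_injective_algebraMap (algebraMap ℚ_[p] K).injective
  refine Field.infinite_absoluteGaloisGroup_of_irreducible K fun n => ?_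
  obtain ⟨ℓ, hnℓ, hℓ⟩ := Nat.exists_infinite_primes (n + Module.finrank ℚ_[p] K + 2)
  have hirr : Irreducible (X ^ ℓ - C (algebraMap ℚ_[p] K p)) :=
    (X_pow_sub_C_irreducible_iff_of_prime hℓ).2
      (forall_pow_ne_algebraMap_of_finrank_lt p hℓ (by omega))
  refine ⟨X ^ ℓ - C (algebraMap ℚ_[p] K p), monic_X_pow_sub_C _ hℓ.ne_zero, hirr,
    PerfectField.separable_of_irreducible hirr, ?_⟩
  rw [natDegree_X_pow_sub_C]
  omega

end Literature.AnabelianGeometry.AbsoluteAnabelian
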